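import Literature.NumberTheory.Transcendental.GammaMonomialsDistribution
import Mathlib.GroupTheory.Perm.Cycle.Type
import Mathlib.Logic.Equiv.Fin.Basic
import HarnessLib

/-!
# Hodge characters of Fermat varieties: prime degree (Ran 1980, Prop. 1.8 (i); Koblitz–Ogus)

Family `hodge`, layer `Literature/AlgebraicGeometry/HodgeTheory`. Brick of the middle-degree case of
the named fact `hodgeClasses_algebraic_fermat` (file `FermatHodgeConjecture`; Shioda, Proc. Japan
Acad. 55A (1979) Thm. 1; Ran, Compositio Math. 42 (1980) Thm. 4.9): the ARITHMETIC of the characters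
indexing the eigenspaces of `Hⁿ(Xⁿₘ(ℂ); ℂ)` under the group `μₘⁿ⁺² / Δ` of diagonal symmetries of
the Fermat variety `Xⁿₘ : x₀ᵐ + ⋯ + x_{n+1}ᵐ = 0`. Everything here is PROVED; no geometry enters.

Shioda (PJA 55A §1, §4; Math. Ann. 245 (1979) §1) and Ran (§1, (1.7)–(1.8)) attach to `Xⁿₘ` the set
`𝔄ⁿₘ = {α = (a₀, …, a_{n+1}) | aᵢ ∈ ℤ/m ∖ {0}, ∑ aᵢ = 0}` (characters with a non-zero primitive
eigenspace `V(α)`, `dim V(α) = 1`), the norm `|α| = (1/m) ∑ ⟨aᵢ⟩` (`⟨a⟩ ∈ [1, m-1]` the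
representative; `V(α) ⊂ H^{|α|-1, n+1-|α|}`) and the set of **Hodge characters**
`𝔅ⁿₘ = {α ∈ 𝔄ⁿₘ | |tα| = n/2 + 1 for all t ∈ (ℤ/m)ˣ}` (so that
`(H^{n/2,n/2} ∩ Hⁿ(X, ℚ)) ⊗ ℂ = V(0) ⊕ ⨁_{α ∈ 𝔅} V(α)`). Ran, Prop. 1.8 (i) (attributed to Parry;
"1.8 (i) follows immediately from the proposition in [3]" = Koblitz–Ogus, appendix to Deligne, PSPM
33.2 (1979)): **if `m` is prime, the Hodge characters are generated under juxtaposition by those in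
dimension `0`**, i.e. every `α ∈ 𝔅ⁿₘ` is, up to a permutation of the coordinates, a juxtaposition
of pairs `(a, -a)` — the characters of the classes of LINEAR SUBSPACES (Ran Thm. 4.9; Shioda's
condition `(Pⁿₘ)` for `m` prime, list item 1 of PJA Thm. 1: `Mₘ` is generated by its `[m/2]`
elements of length `1`).

* `FermatCharacter.normSum α = ∑ ⟨αᵢ⟩ = m |α|`, `FermatCharacter.IsAdmissible` (`𝔄`),
  `FermatCharacter.IsHodge` (`𝔅`, spelled `2 |tα| = n + 2`, which forces `n` even:
  `IsHodge.even`), `FermatCharacter.IsPaired` (a fixed-point-free involution `σ` of the index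
  set with `α ∘ σ = -α`: "juxtaposition of dimension-`0` Hodge characters up to permutation");
* `normSum_add_normSum_neg`: `|α| + |-α| = n + 2` on `𝔄` (Hodge symmetry `V(-α) = \overline{V(α)}`);
* `IsPaired.isHodge`: juxtapositions of pairs are Hodge characters (every `m`);
* `IsHodge.card_filter_eq_card_filter_neg`, **`IsHodge.isPaired`**: for `m` prime, a Hodge
  character takes every value as often as its negative, hence is paired (Ran Prop. 1.8 (i)). The
  proof is Koblitz–Ogus's, through the tree's PROVED linear-algebra form
  `KoblitzOgus.hodge_eq_combination` (file `NumberTheory/Transcendental/GammaMonomialsDistribution`,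
  whose one arithmetic input is `L(0, χ) = -B_{1,χ} ≠ 0` for odd `χ`): the multiplicity function
  `f(x) = #{i | αᵢ = x}` on `ℤ/p` satisfies `∑ₓ f(x) (⟨ux⟩/p - 1/2) = |uα| - (n+2)/2 = 0` for all
  units `u`, hence is a `ℚ`-combination of the reflection vectors `e_a + e_{-a}` and the
  distribution vectors for the divisors `1, p` of `p` (which are `∑_{x ≠ 0} e_x` and `0`), all of
  them even functions; so `f(-x) = f(x)`, and pairing the fibres of `α` over `x` and `-x` gives `σ`.
* stability of `𝔅` under units, permutations and negation (`IsHodge.unitSMul`, `.compEquiv`, `.neg`).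

## References

* [Ran1980] Z. Ran, Cycles on Fermat hypersurfaces, Compositio Math. 42 (1980) 121–142, §1
  (1.7)–(1.8), Prop. 1.8 (i) (p. 125–126), Thm. 4.9 (p. 141) (text read, numdam).
* [Shioda1979PJA] T. Shioda, The Hodge conjecture and the Tate conjecture for Fermat varieties,
  Proc. Japan Acad. 55A (1979) 111–114, §1 (the semigroup `Mₘ(H)`, its `[m/2]` elements of length
  `1`), §2 Thm. 1 list item 1), §4 (`𝔄ⁿₘ`, `V(α)`) (text read).
* [KoblitzOgus1979] N. Koblitz, A. Ogus, Algebraicity of some products of values of the `Γ`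
  function, appendix to P. Deligne, Valeurs de fonctions `L` et périodes d'intégrales, Proc. Symp.
  Pure Math. 33.2 (1979) 343–346 (through the tree's `KoblitzOgus.hodge_eq_combination`).
-/

noncomputable section

open Finset

namespace Literature.AlgebraicGeometry.HodgeTheory

namespace FermatCharacter

variable {m r : ℕ}

/-! ### The norm, admissible characters, Hodge characters, paired characters -/

/-- `m |α| = ∑ᵢ ⟨αᵢ⟩`, the sum of the representatives in `[0, m-1]` of the components of a
character `α = (α₀, …, α_{r-1})` of `μₘʳ` (Shioda's `|α|` is `normSum α / m`; Ran's `s(χ) + 1`).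
[cite: Shioda1979PJA, §1 eq. (2) and §4] [cite: Ran1980, §1 (1.7)] -/
def normSum (α : Fin r → ZMod m) : ℕ := ∑ i, (α i).val

/-- `α ∈ 𝔄`: all components non-zero and `∑ αᵢ = 0` — the characters of `μₘʳ/Δ` occurring in the
primitive middle cohomology of the Fermat variety `x₀ᵐ + ⋯ + x_{r-1}ᵐ = 0`.
[cite: Shioda1979PJA, §1 eq. (3) and §4] [cite: Ran1980, §1 Prop. 1.7] -/
def IsAdmissible (α : Fin r → ZMod m) : Prop := (∀ i, α i ≠ 0) ∧ ∑ i, α i = 0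

/-- `α ∈ 𝔅`, a **Hodge character**: admissible and `2 |tα| = r` for every unit `t ∈ (ℤ/m)ˣ`
(for `r = n + 2`: `|tα| = n/2 + 1`, the condition that `⨁ₜ V(tα)`, which is defined over `ℚ`, be of
Hodge type `(n/2, n/2)`). [cite: Shioda1979PJA, §1 eq. (2), condition on the length] [cite: Ran1980, §1 (1.8) "Hodge character"] -/
def IsHodge (α : Fin r → ZMod m) : Prop :=
  IsAdmissible α ∧ ∀ t : (ZMod m)ˣ, 2 * normSum (fun i ↦ (t : ZMod m) * α i) = m * r

/-- `α` is **paired**: up to a permutation of the index set it is a juxtaposition of dimension-`0`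
Hodge characters `(a, -a)`, i.e. there is a fixed-point-free involution `σ` of the indices with
`α (σ i) = -α i`. These index the linear subspaces `x_i = ε x_{σ i}` (`εᵐ = -1`) of the Fermat
variety. [cite: Ran1980, Prop. 1.8 (i) and Thm. 4.9] [cite: Shioda1979PJA, §1 (elements of length 1)] -/
def IsPaired (α : Fin r → ZMod m) : Prop :=
  ∃ σ : Equiv.Perm (Fin r), (∀ i, σ i ≠ i) ∧ (∀ i, σ (σ i) = i) ∧ ∀ i, α (σ i) = -α i

/-! ### Elementary properties -/

/-- `⟨a⟩ + ⟨-a⟩ = m` for `a ≠ 0` in `ℤ/m`. [folklore] -/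
theorem val_add_val_neg [NeZero m] {a : ZMod m} (ha : a ≠ 0) : a.val + (-a).val = m := by
  rw [ZMod.neg_val, if_neg ha]
  have := ZMod.val_lt a
  omega

/-- **`|α| + |-α| = r`** (i.e. `n + 2`) when all components are non-zero: the eigenspaces `V(α)`
and `V(-α) = \overline{V(α)}` have complex-conjugate Hodge types. [cite: Ran1980, §1 (1.7)] -/
theorem normSum_add_normSum_neg [NeZero m] {α : Fin r → ZMod m} (hα : ∀ i, α i ≠ 0) :
    normSum α + normSum (-α) = m * r := by
  unfold normSum
  rw [← Finset.sum_add_distrib]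
  simp_rw [Pi.neg_apply, fun i ↦ val_add_val_neg (hα i)]
  simp [mul_comm]

/-- The sum of the components is the residue of `m |α|`. [folklore] -/
theorem natCast_normSum [NeZero m] (α : Fin r → ZMod m) : (normSum α : ZMod m) = ∑ i, α i := by
  simp [normSum]

/-- A paired character has all `2 |tα| = r`. [cite: Ran1980, §1 (1.8)] -/
theorem IsPaired.two_mul_normSum [NeZero m] {α : Fin r → ZMod m} (h : IsPaired α)
    (hα : ∀ i, α i ≠ 0) (t : (ZMod m)ˣ) :
    2 * normSum (fun i ↦ (t : ZMod m) * α i) = m * r := by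
  obtain ⟨σ, -, -, hσα⟩ := h
  have hre : normSum (fun i ↦ (t : ZMod m) * α i) = ∑ i, ((t : ZMod m) * α (σ i)).val :=
    (Equiv.sum_comp σ (fun i ↦ ((t : ZMod m) * α i).val)).symm
  have hne : ∀ i, (t : ZMod m) * α i ≠ 0 := fun i ↦ (Units.mul_right_eq_zero t).not.mpr (hα i)
  calc 2 * normSum (fun i ↦ (t : ZMod m) * α i)
      = normSum (fun i ↦ (t : ZMod m) * α i) + ∑ i, ((t : ZMod m) * α (σ i)).val := by
        rw [two_mul, ← hre]
    _ = ∑ i, (((t : ZMod m) * α i).val + (-((t : ZMod m) * α i)).val) := by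
        rw [normSum, ← Finset.sum_add_distrib]
        refine Finset.sum_congr rfl fun i _ ↦ ?_
        rw [hσα i, mul_neg]
    _ = m * r := by simp [fun i ↦ val_add_val_neg (hne i), mul_comm]

/-- A fixed-point-free involution lives on an even set. [folklore] -/
theorem even_of_perm {σ : Equiv.Perm (Fin r)} (h1 : ∀ i, σ i ≠ i) (h2 : ∀ i, σ (σ i) = i) :
    Even r := by
  classical
  haveI : Fact (Nat.Prime 2) := ⟨Nat.prime_two⟩
  have hσ : σ ^ 2 ^ 1 = 1 := by
    ext i
    simp [pow_two, h2 i]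
  have hsupp : σ.supportᶜ = ∅ := by
    ext i
    simp [Equiv.Perm.mem_support, h1 i]
  have := Equiv.Perm.card_compl_support_modEq hσ
  rw [hsupp, Finset.card_empty, Fintype.card_fin] at this
  exact even_iff_two_dvd.mpr (Nat.modEq_zero_iff_dvd.mp this.symm)

/-- **Paired characters with non-zero components are Hodge characters** (every `m`): the pairs
`(a, -a)` are the Hodge characters in dimension `0`, and juxtaposition adds norms.
[cite: Ran1980, §1 (1.8) and Prop. 1.8] -/
theorem IsPaired.isHodge [NeZero m] {α : Fin r → ZMod m} (h : IsPaired α) (hα : ∀ i, α i ≠ 0) :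
    IsHodge α := by
  refine ⟨⟨hα, ?_⟩, h.two_mul_normSum hα⟩
  obtain ⟨k, hk⟩ := even_of_perm h.choose_spec.1 h.choose_spec.2.1
  have h1 := h.two_mul_normSum hα 1
  simp only [Units.val_one, one_mul] at h1
  change 2 * normSum α = m * r at h1
  have hnorm : normSum α = m * k := by
    apply Nat.eq_of_mul_eq_mul_left zero_lt_two
    rw [h1, hk]
    ring
  rw [← natCast_normSum, hnorm]
  simp

/-- A Hodge character lives on an even index set (`n` is even). [cite: Shioda1979PJA, §2 ("non-trivial only in case n is even")] -/
theorem IsHodge.even_card [NeZero m] {α : Fin r → ZMod m} (h : IsHodge α) : Even (m * r) := by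
  have h1 := h.2 1
  exact ⟨_, by rw [← h1, two_mul]⟩

/-- **A Hodge character lives on an even index set: `r` (`= n + 2`) is even**, for every `m ≥ 1`:
`2 |α| m = m r` with `m ∣ m|α|` because `Σ αᵢ = 0`. [cite: Shioda1979PJA, §2 ("non-trivial only in case n is even")] -/
theorem IsHodge.even [NeZero m] {α : Fin r → ZMod m} (h : IsHodge α) : Even r := by
  have h1 := h.2 1
  simp only [Units.val_one, one_mul] at h1
  change 2 * normSum α = m * r at h1
  have hdvd : m ∣ normSum α := by
    rw [← ZMod.natCast_eq_zero_iff, natCast_normSum, h.1.2]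
  obtain ⟨k, hk⟩ := hdvd
  refine ⟨k, Nat.eq_of_mul_eq_mul_left (NeZero.pos m) ?_⟩
  rw [← h1, hk]
  ring

/-- `𝔅` is stable under the units: `α ∈ 𝔅 ⇒ uα ∈ 𝔅`. [cite: Shioda1979PJA, §1] -/
theorem IsHodge.unitSMul {α : Fin r → ZMod m} (h : IsHodge α) (u : (ZMod m)ˣ) :
    IsHodge fun i ↦ (u : ZMod m) * α i := by
  refine ⟨⟨fun i ↦ (Units.mul_right_eq_zero u).not.mpr (h.1.1 i), ?_⟩, fun t ↦ ?_⟩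
  · rw [← Finset.mul_sum, h.1.2, mul_zero]
  · simpa [mul_assoc] using h.2 (t * u)

/-- `𝔅` is stable under permutations of the coordinates. [cite: Shioda1979PJA, §1] -/
theorem IsHodge.compEquiv {α : Fin r → ZMod m} (h : IsHodge α) (π : Equiv.Perm (Fin r)) :
    IsHodge (α ∘ π) := by
  refine ⟨⟨fun i ↦ h.1.1 (π i), ?_⟩, fun t ↦ ?_⟩
  · rw [show ∑ i, (α ∘ π) i = ∑ i, α i from Equiv.sum_comp π α, h.1.2]
  · have := h.2 t
    unfold normSum at this ⊢
    rwa [show ∑ i, ((t : ZMod m) * (α ∘ π) i).val = ∑ i, ((t : ZMod m) * α i).val from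
      Equiv.sum_comp π (fun i ↦ ((t : ZMod m) * α i).val)]

/-- `𝔅` is stable under negation (complex conjugation `V(α) ↦ V(-α)`). [cite: Ran1980, §1 (1.7)] -/
theorem IsHodge.neg [NeZero m] {α : Fin r → ZMod m} (h : IsHodge α) : IsHodge (-α) := by
  have := h.unitSMul (-1)
  simp only [Units.val_neg, Units.val_one, neg_mul, one_mul] at this
  exact this

/-! ### Pairing from the symmetry of the multiplicities -/

/-- If `α` takes each value `x` as often as `-x` and never takes a value with `a = -a`, then `α` is
paired: orient each pair `{x, -x}` by `⟨x⟩ < ⟨-x⟩` and match the fibres. [folklore] -/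
theorem isPaired_of_card_filter_eq [NeZero m] {α : Fin r → ZMod m} (hne : ∀ i, α i ≠ -α i)
    (hcard : ∀ x : ZMod m, #{i | α i = x} = #{i | α i = -x}) : IsPaired α := by
  classical
  -- orientation of the pairs `{x, -x}`
  let P : ZMod m → Prop := fun x ↦ x.val < (-x).val
  have hP : ∀ i, ¬ P (α i) ↔ P (-α i) := by
    intro i
    have hv : (α i).val ≠ (-α i).val := fun h ↦ hne i (ZMod.val_injective m h)
    simp only [P, neg_neg, not_lt]
    exact ⟨fun h ↦ lt_of_le_of_ne h (Ne.symm hv), le_of_lt⟩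
  -- the two halves of the index set and the fibrewise matching
  let I₁ := {i : Fin r // P (α i)}
  let I₂ := {i : Fin r // ¬ P (α i)}
  let f : I₁ → ZMod m := fun i ↦ α i.1
  let g : I₂ → ZMod m := fun j ↦ -α j.1
  have hfib : ∀ c : ZMod m, Fintype.card {i : I₁ // f i = c} = Fintype.card {j : I₂ // g j = c} := by
    intro c
    rw [Fintype.card_congr (Equiv.subtypeSubtypeEquivSubtypeInter (fun i : Fin r ↦ P (α i)) (fun i ↦ α i = c)),
      Fintype.card_congr (Equiv.subtypeSubtypeEquivSubtypeInter (fun i : Fin r ↦ ¬ P (α i)) (fun i ↦ -α i = c)),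
      Fintype.card_subtype, Fintype.card_subtype]
    by_cases hc : P c
    · have h1 : (univ.filter fun i : Fin r ↦ P (α i) ∧ α i = c) = univ.filter fun i ↦ α i = c := by
        ext i
        simp only [mem_filter, mem_univ, true_and, and_iff_right_iff_imp]
        rintro rfl; exact hc
      have h2 : (univ.filter fun i : Fin r ↦ ¬ P (α i) ∧ -α i = c) = univ.filter fun i ↦ α i = -c := by
        ext i
        simp only [mem_filter, mem_univ, true_and, neg_eq_iff_eq_neg]
        constructor
        · exact fun h ↦ h.2
        · intro h
          refine ⟨?_, h⟩
          rw [hP i, h, neg_neg]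
          exact hc
      rw [h1, h2, hcard c]
    · have h1 : (univ.filter fun i : Fin r ↦ P (α i) ∧ α i = c) = ∅ := by
        ext i
        simp only [mem_filter, mem_univ, true_and, Finset.notMem_empty, iff_false, not_and]
        rintro h rfl; exact hc h
      have h2 : (univ.filter fun i : Fin r ↦ ¬ P (α i) ∧ -α i = c) = ∅ := by
        ext i
        simp only [mem_filter, mem_univ, true_and, Finset.notMem_empty, iff_false, not_and]
        rintro h rfl; exact hc ((hP i).mp h)
      rw [h1, h2]
  let E : I₁ ≃ I₂ := Equiv.ofFiberEquiv fun c ↦ Fintype.equivOfCardEq (hfib c)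
  have hE : ∀ i : I₁, α (E i).1 = -α i.1 := fun i ↦ by
    have := Equiv.ofFiberEquiv_map (fun c ↦ Fintype.equivOfCardEq (hfib c)) i
    simp only [f, g] at this
    rw [← this, neg_neg]
  have hE' : ∀ j : I₂, α (E.symm j).1 = -α j.1 := fun j ↦ by
    have := hE (E.symm j)
    rw [Equiv.apply_symm_apply] at this
    rw [this, neg_neg]
  -- the involution: swap the halves through `E`
  let τ : Equiv.Perm (I₁ ⊕ I₂) := (Equiv.sumCongr E E.symm).trans (Equiv.sumComm I₂ I₁)
  let e : I₁ ⊕ I₂ ≃ Fin r := Equiv.sumCompl fun i ↦ P (α i)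
  have hτ : ∀ y, τ (τ y) = y := by
    rintro (i | j) <;> simp [τ]
  have hτne : ∀ y, τ y ≠ y := by
    rintro (i | j) <;> simp [τ]
  have hτα : ∀ y, α (e (τ y)) = -α (e y) := by
    rintro (i | j)
    · exact hE i
    · exact hE' j
  refine ⟨e.symm.trans (τ.trans e), fun i h ↦ hτne (e.symm i) ?_, fun i ↦ ?_, fun i ↦ ?_⟩
  · simpa using congrArg e.symm h
  · simp [hτ]
  · simpa using hτα (e.symm i)

/-- A constant character `(a, …, a)` with `a = -a` on an even index set is paired (any
fixed-point-free involution will do). [folklore] -/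
theorem isPaired_of_forall_eq_neg {α : Fin r → ZMod m} (hr : Even r) (hc : ∀ i j, α i = α j)
    (ha : ∀ i, α i = -α i) : IsPaired α := by
  obtain ⟨k, rfl⟩ := hr
  let e : Fin k ⊕ Fin k ≃ Fin (k + k) := finSumFinEquiv
  refine ⟨e.symm.trans ((Equiv.sumComm (Fin k) (Fin k)).trans e), fun i h ↦ ?_, fun i ↦ ?_,
    fun i ↦ ?_⟩
  · have h' : Sum.swap (e.symm i) = e.symm i := by
      have h'' := congrArg e.symm h
      rwa [Equiv.trans_apply, Equiv.trans_apply, Equiv.symm_apply_apply] at h''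
    cases hy : e.symm i with
    | inl a => rw [hy] at h'; exact Sum.inr_ne_inl h'
    | inr b => rw [hy] at h'; exact Sum.inl_ne_inr h'
  · show e (Sum.swap (e.symm (e (Sum.swap (e.symm i))))) = i
    rw [Equiv.symm_apply_apply, Sum.swap_swap, Equiv.apply_symm_apply]
  · rw [← ha i]; exact hc _ _

/-! ### Prime degree: Hodge characters are paired (Ran Prop. 1.8 (i); Koblitz–Ogus) -/

/-- The non-zero element of `ℤ/2` is `1 = -1`. [folklore] -/
theorem zmod_two_eq_one_of_ne_zero : ∀ a : ZMod 2, a ≠ 0 → a = 1 ∧ a = -1 := by decide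

section Prime

variable {p : ℕ} [hp : Fact p.Prime]

/-- The Bernoulli pairing of the multiplicity function of a Hodge character vanishes:
`∑ₓ #{i | αᵢ = x} β(ux) = |uα| - r/2 = 0` for every unit `u` (`β(y) = ⟨y⟩/p - 1/2`, `β(0) = 0`).
[cite: Ran1980, §1 (1.8)] -/
theorem IsHodge.sum_card_mul_bernoulli_eq_zero {α : Fin r → ZMod p} (h : IsHodge α)
    {u : ZMod p} (hu : IsUnit u) :
    ∑ x : ZMod p, (#{i | α i = x} : ℚ) *
      (if u * x = (0 : ZMod p) then (0 : ℚ) else (((ZMod.val (u * x) : ℕ) : ℚ) / (p : ℚ) - 1 / 2)) = 0 := by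
  classical
  obtain ⟨t, rfl⟩ := hu
  have hne : ∀ i, (t : ZMod p) * α i ≠ 0 := fun i ↦ (Units.mul_right_eq_zero t).not.mpr (h.1.1 i)
  -- regroup the sum over the values into a sum over the indices
  have key : ∀ x : ZMod p, (#{i | α i = x} : ℚ) *
      (if (t : ZMod p) * x = 0 then (0 : ℚ) else ((((t : ZMod p) * x).val : ℚ) / p - 1 / 2)) =
      ∑ i ∈ univ.filter (fun i ↦ α i = x),
        (if (t : ZMod p) * α i = 0 then (0 : ℚ) else ((((t : ZMod p) * α i).val : ℚ) / p - 1 / 2)) := by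
    intro x
    rw [Finset.sum_congr rfl (g := fun _ ↦
      (if (t : ZMod p) * x = 0 then (0 : ℚ) else ((((t : ZMod p) * x).val : ℚ) / p - 1 / 2))) fun i hi ↦ by
        rw [(Finset.mem_filter.mp hi).2]]
    rw [Finset.sum_const, nsmul_eq_mul]
  simp_rw [key]
  rw [Finset.sum_fiberwise_of_maps_to (g := α) (fun i _ ↦ Finset.mem_univ (α i))]
  simp_rw [if_neg (hne _)]
  rw [Finset.sum_sub_distrib, Finset.sum_const, Finset.card_univ, Fintype.card_fin, nsmul_eq_mul,
    ← Finset.sum_div]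
  have h2 := h.2 t
  unfold normSum at h2
  have hp0 : (p : ℚ) ≠ 0 := by exact_mod_cast hp.out.ne_zero
  have h2' : (∑ i, ((((t : ZMod p) * α i).val : ℕ) : ℚ)) = (p : ℚ) * r / 2 := by
    have := congrArg (Nat.cast (R := ℚ)) h2
    push_cast at this
    linarith
  rw [h2']
  field_simp
  ring

/-- **A Hodge character of prime level takes every value as often as its negative**
(`#{i | αᵢ = x} = #{i | αᵢ = -x}`): by Koblitz–Ogus (`KoblitzOgus.hodge_eq_combination`) the
multiplicity function is a `ℚ`-combination of the reflection vectors `e_a + e_{-a}` and of the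
distribution vectors attached to the divisors `1` and `p` of `p`, all of which are even functions
on `ℤ/p`. [cite: Ran1980, Prop. 1.8 (i)] [cite: KoblitzOgus1979, Proposition (appendix, PSPM 33.2 pp. 343–346)] -/
theorem IsHodge.card_filter_eq_card_filter_neg {α : Fin r → ZMod p} (h : IsHodge α) (x : ZMod p) :
    #{i | α i = x} = #{i | α i = -x} := by
  classical
  obtain ⟨cr, cd, hf⟩ := Literature.NumberTheory.Transcendental.KoblitzOgus.hodge_eq_combination (N := p) (fun x ↦ (#{i | α i = x} : ℚ))
    (fun u hu ↦ h.sum_card_mul_bernoulli_eq_zero hu)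
  -- each basis vector is an even function of `x`
  have hrefl : ∀ a y : ZMod p, ((if a = -y then (1 : ℚ) else 0) + if -a = -y then 1 else 0) =
      ((if a = y then (1 : ℚ) else 0) + if -a = y then 1 else 0) := by
    intro a y
    rw [add_comm]
    congr 1
    · simp only [neg_inj]
    · congr 1
      simp only [eq_neg_iff_add_eq_zero, neg_eq_iff_add_eq_zero]
  have hanti : ∀ y z : ZMod p, ((if z = y then (1 : ℚ) else 0) - if y = z then 1 else 0) = 0 := by
    intro y z
    by_cases hzy : z = y
    · subst hzy; simp
    · rw [if_neg hzy, if_neg (Ne.symm hzy), sub_zero]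
  have hdist : ∀ M ∈ p.divisors, ∀ y z : ZMod p,
      ((if z.val % M = y.val % M then (1 : ℚ) else 0) - if ((p / M : ℕ) : ZMod p) * y = z then 1 else 0) =
      ((if (-z).val % M = y.val % M then (1 : ℚ) else 0) - if ((p / M : ℕ) : ZMod p) * y = -z then 1 else 0) := by
    intro M hM y z
    obtain hM1 | hMp := (Nat.dvd_prime hp.out).mp (Nat.dvd_of_mem_divisors hM)
    · subst hM1
      simp only [Nat.mod_one, Nat.div_one, ZMod.natCast_self, zero_mul, ↓reduceIte]
      congr 2
      simp only [eq_comm (a := (0 : ZMod p)), neg_eq_zero]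
    · rw [hMp]
      have hval : ∀ w : ZMod p, w.val % p = w.val := fun w ↦ Nat.mod_eq_of_lt (ZMod.val_lt w)
      simp only [hval, Nat.div_self hp.out.pos, Nat.cast_one, one_mul,
        (ZMod.val_injective p).eq_iff]
      rw [hanti y z, hanti y (-z)]
  have e : (#{i | α i = x} : ℚ) = #{i | α i = -x} := by
    rw [hf x, hf (-x)]
    congr 1
    · exact Finset.sum_congr rfl fun a _ ↦ by rw [hrefl a x]
    · exact Finset.sum_congr rfl fun M hM ↦ Finset.sum_congr rfl fun y _ ↦ by rw [hdist M hM y x]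
  exact_mod_cast e

/-- **Ran 1980, Prop. 1.8 (i) (Parry; Koblitz–Ogus): for `m = p` prime every Hodge character is a
juxtaposition of pairs `(a, -a)` up to permutation** — Shioda's condition `(Pⁿₚ)` (PJA Thm. 1,
list item 1: `Mₚ` is generated by its elements of length `1`). For `p` odd no component equals its
negative and the fibres over `x` and `-x` are matched; for `p = 2` the character is `(1, …, 1)` on
an even set. [cite: Ran1980, Prop. 1.8 (i)] [cite: Shioda1979PJA, §2 Thm. 1, list item 1)] -/
theorem IsHodge.isPaired {α : Fin r → ZMod p} (h : IsHodge α) : IsPaired α := by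
  by_cases h2 : p = 2
  · subst h2
    have hone : ∀ i, α i = 1 := fun i ↦ (zmod_two_eq_one_of_ne_zero _ (h.1.1 i)).1
    refine isPaired_of_forall_eq_neg ?_ (fun i j ↦ by rw [hone i, hone j]) fun i ↦ by
      rw [hone i]; exact (zmod_two_eq_one_of_ne_zero 1 one_ne_zero).2
    have hsum := h.1.2
    simp_rw [hone, Finset.sum_const, Finset.card_univ, Fintype.card_fin, nsmul_eq_mul, mul_one] at hsum
    exact (ZMod.natCast_eq_zero_iff_even).mp hsum
  · have hodd : p ≠ 2 := h2
    refine isPaired_of_card_filter_eq (fun i hi ↦ h.1.1 i ?_) h.card_filter_eq_card_filter_neg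
    -- `a = -a` forces `2a = 0`, hence `a = 0` in `ℤ/p`, `p` odd
    have h2a : (2 : ZMod p) * α i = 0 := by rw [two_mul]; nth_rw 2 [hi]; exact add_neg_cancel _
    have h2u : (2 : ZMod p) ≠ 0 := by
      intro h0
      have : (p : ℕ) ∣ 2 := (ZMod.natCast_eq_zero_iff 2 p).mp (by exact_mod_cast h0)
      exact hodd ((Nat.prime_dvd_prime_iff_eq hp.out Nat.prime_two).mp this)
    exact (mul_eq_zero.mp h2a).resolve_left h2u

/-- **Prime degree, summary**: for `m = p` prime and `α` with non-zero components, `α` is a Hodge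
character iff it is paired. [cite: Ran1980, Prop. 1.8 (i)] -/
theorem isHodge_iff_isPaired {α : Fin r → ZMod p} (hα : ∀ i, α i ≠ 0) : IsHodge α ↔ IsPaired α :=
  ⟨IsHodge.isPaired, fun h ↦ h.isHodge hα⟩

end Prime

end FermatCharacter

end Literature.AlgebraicGeometry.HodgeTheory

end
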